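import Literature.Computability.MetaComplexity.BoundedArithS2Algebra
import Literature.Computability.MetaComplexity.BoundedArithComposition
import HarnessLib

/-!
# Powers of two and division by powers of two (`MSP`, `LSP`) in models of `S₂¹`

Topic `Literature/Computability/MetaComplexity`.  Second layer of the bootstrapping of Buss's
`S₂¹` *inside an arbitrary model* `M ⊨ BASIC + Σᵇ₁-PIND` (Buss 1986, §§2.4–2.5: the functions
`2^{|x|}`, `MSP(x, i) = ⌊x / 2ⁱ⌋`, `LSP(x, i) = x mod 2ⁱ`, `Bit`; Krajíček 1995, §5.4), the `S₂¹`
counterpart of `BoundedArithPow2.lean` (which works in models of `T₂¹`), in the algebraic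
notation of the namespace `BASICModel`:

* `parity x ∈ {0, 1}` with `2·⌊x/2⌋ + parity x = x` (from `BASIC`);
* powers of two of every length `k + 1 ≤ |S| + 1` exist (`1 # y` for `|y| = k`, `y ≤ S`:
  `BoundedArithS2LIND`, `BoundedArithS2SuccIND`) and are unique (`IsPow.eq_of_mLen_eq`); the
  resulting `Σᵇ₁`-definable function `pw S k = 2 ^ min(k, |S|)` with its recursion equations and
  order properties (`lt_pw_iff : x < 2ᵏ ↔ |x| ≤ k`);
* **division with remainder by a power of two** without subtraction: for every `a` and every power
  of two `v` there are unique `q ≤ a`, `r < v` with `a = q·v + r` (`exists_divmod_isPow`, by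
  `Σᵇ₁`-induction along the lengths `[0, |a|]` doubling `v` — `(2h + e)·v + r = h·(2v) + (e·v + r)`;
  `divmod_unique`);
* the functions `msp S a k = ⌊a / 2ᵏ⌋` and `lsp S a k = a mod 2ᵏ` (`k ≤ |S|`; Buss's `MSP`, `LSP`)
  with their specification, bounds and `Σᵇ₁`-definability (`isSigmabFn_msp`, `isSigmabFn_lsp`,
  `isSigmabFn_pw`), and the first recursion equations (`msp_succ : ⌊a/2ᵏ⁺¹⌋ = ⌊⌊a/2ᵏ⌋/2⌋`).

## References

* S. R. Buss, *Bounded Arithmetic*, Bibliopolis 1986, §§2.4–2.5.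
* J. Krajíček, *Bounded Arithmetic, Propositional Logic and Complexity Theory*, CUP 1995, §5.4
  (p. 75).

## Design choices

* All exponents are taken below a *size parameter* `S` (`2ᵏ` for `k ≤ |S|`), as in the `T₂¹`
  tier (`pow2B`), so that every function is total and bounded by a term (`1 # S`, `a`).
* No subtraction is used (it is not yet available in this tier); the remainder is carried along.
* Hypotheses: instance arguments `[M ⊨ BASIC]`, `[M ⊨ PINDScheme (sigmabFormulas 1)]`.
-/

namespace Literature.Computability.MetaComplexity

open FirstOrder FirstOrder.Language

namespace BASICModel

variable {M : Type} [Language.boundedArith.Structure M]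

/-! ### Evaluation of `Fin.snoc` on `Fin 5 → M` (cf. `BoundedArithComposition.lean`) -/

omit [Language.boundedArith.Structure M] in
/-- Evaluation of `Fin.snoc` on `Fin 5 → M`, coordinate `0`. [folklore] -/
@[simp] theorem snoc_fin_five_zero (w : Fin 5 → M) (y : M) : (Fin.snoc w y : Fin 6 → M) 0 = w 0 :=
  rfl

omit [Language.boundedArith.Structure M] in
/-- Evaluation of `Fin.snoc` on `Fin 5 → M`, coordinate `1`. [folklore] -/
@[simp] theorem snoc_fin_five_one (w : Fin 5 → M) (y : M) : (Fin.snoc w y : Fin 6 → M) 1 = w 1 :=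
  rfl

omit [Language.boundedArith.Structure M] in
/-- Evaluation of `Fin.snoc` on `Fin 5 → M`, coordinate `2`. [folklore] -/
@[simp] theorem snoc_fin_five_two (w : Fin 5 → M) (y : M) : (Fin.snoc w y : Fin 6 → M) 2 = w 2 :=
  rfl

omit [Language.boundedArith.Structure M] in
/-- Evaluation of `Fin.snoc` on `Fin 5 → M`, coordinate `3`. [folklore] -/
@[simp] theorem snoc_fin_five_three (w : Fin 5 → M) (y : M) :
    (Fin.snoc w y : Fin 6 → M) 3 = w 3 := rfl

omit [Language.boundedArith.Structure M] in
/-- Evaluation of `Fin.snoc` on `Fin 5 → M`, coordinate `4`. [folklore] -/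
@[simp] theorem snoc_fin_five_four (w : Fin 5 → M) (y : M) :
    (Fin.snoc w y : Fin 6 → M) 4 = w 4 := rfl

omit [Language.boundedArith.Structure M] in
/-- Evaluation of `Fin.snoc` on `Fin 5 → M`, last coordinate. [folklore] -/
@[simp] theorem snoc_fin_five_five (w : Fin 5 → M) (y : M) :
    (Fin.snoc w y : Fin 6 → M) 5 = y := rfl

section S21

variable [hB : M ⊨ BASIC] [hP : M ⊨ PINDScheme (sigmabFormulas 1)]

/-! ## Parity -/

open scoped Classical in
/-- `parity x = x mod 2`: `0` if `x = 2⌊x/2⌋`, else `1` (axiom 32 of `BASIC`; Buss's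
`Bit(0, x)`). [cite: Buss1986, §2.4] -/
noncomputable def parity (x : M) : M := if 2 * mHalf x = x then 0 else 1

omit hP in
/-- `2⌊x/2⌋ + parity x = x`. [cite: Buss1986, §2.4] -/
theorem two_mul_mHalf_add_parity (x : M) : 2 * mHalf x + parity x = x := by
  unfold parity
  split_ifs with h
  · rw [add_zero, h]
  · rcases two_mul_mHalf_or x with h' | h'
    · exact absurd h' h
    · exact h'

omit hP in
/-- `parity x = 0 ∨ parity x = 1`. [folklore] -/
theorem parity_eq_zero_or_one (x : M) : parity x = 0 ∨ parity x = 1 := by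
  unfold parity
  split_ifs
  · exact Or.inl rfl
  · exact Or.inr rfl

omit hP in
/-- `parity x ≤ 1`. [folklore] -/
theorem parity_le_one (x : M) : parity x ≤ 1 := by
  rcases parity_eq_zero_or_one x with h | h
  · rw [h]; exact bot_le
  · rw [h]

omit hP in
/-- `parity (2x) = 0`. [folklore] -/
@[simp] theorem parity_two_mul (x : M) : parity (2 * x) = 0 := by
  unfold parity
  rw [if_pos]
  rw [mHalf_two_mul]

omit hP in
/-- `parity (2x + 1) = 1`. [folklore] -/
@[simp] theorem parity_two_mul_add_one (x : M) : parity (2 * x + 1) = 1 := by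
  unfold parity
  rw [if_neg]
  rw [mHalf_two_mul_add_one]
  exact two_mul_ne_two_mul_add_one x x

omit hP in
/-- `parity 0 = 0`. [folklore] -/
@[simp] theorem parity_zero : parity (0 : M) = 0 := by simpa using parity_two_mul (0 : M)

omit hP in
/-- `parity 1 = 1`. [folklore] -/
@[simp] theorem parity_one : parity (1 : M) = 1 := by simpa using parity_two_mul_add_one (0 : M)

omit hP in
/-- Uniqueness of the decomposition `x = 2h + e`, `e ≤ 1`. [folklore] -/
theorem eq_mHalf_and_eq_parity {x h e : M} (he : e ≤ 1) (hx : 2 * h + e = x) :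
    h = mHalf x ∧ e = parity x := by
  rcases he.eq_or_lt with rfl | hlt
  · subst hx
    simp
  · have he0 : e = 0 := le_antisymm ((lt_add_one_iff' e 0).1 (by simpa using hlt)) bot_le
    subst he0
    rw [add_zero] at hx
    subst hx
    simp

omit hP in
/-- The graph of `parity`: `e = parity x ↔ (2⌊x/2⌋ = x ∧ e = 0) ∨ (2⌊x/2⌋ ≠ x ∧ e = 1)` (open).
[folklore] -/
theorem eq_parity_iff {x e : M} :
    e = parity x ↔ (2 * mHalf x = x ∧ e = 0) ∨ (2 * mHalf x ≠ x ∧ e = 1) := by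
  unfold parity
  split_ifs with h
  · simp [h]
  · simp [h]

omit hP in
/-- The graph of `parity` is open-definable (for term arguments). [folklore] -/
theorem isQFDef_parity_graph {m : ℕ} {F E : (Fin m → M) → M} (hF : IsTermFn F) (hE : IsTermFn E) :
    IsQFDef fun xs => E xs = parity (F xs) := by
  refine (((IsQFDef.eq (isTermFn_two_mul hF.half) hF).and (IsQFDef.eq hE isTermFn_zero)).or
    ((isQFDef_ne (isTermFn_two_mul hF.half) hF).and (IsQFDef.eq hE isTermFn_one))).of_iff
    fun xs => ?_
  exact eq_parity_iff.symm

omit hP in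
/-- `parity` is a `Σᵇᵢ`-definable function for every `i` (open graph, bounded by `1`).
[cite: Buss1986, §2.4] -/
theorem isSigmabFn_parity (i : ℕ) : IsSigmabFn i fun v : Fin 1 → M => parity (v 0) := by
  refine ⟨((isQFDef_parity_graph (IsTermFn.proj 0) (IsTermFn.proj 1)).isSigmabDef i).of_iff
    fun v => ?_, fun _ => 1, isTermFn_one, fun v => parity_le_one (v 0)⟩
  simp [graphPred, Fin.init]

/-! ## Powers of two of a given length -/

/-- **For every `k ≤ |S|` there is a power of two of length `k + 1` below `1 # S`**: with
`y ≤ S` of length `k` (`BASICModel.exists_le_mLen_eq`) take `1 # y` (`BASICModel.isPow_one_mSmash`)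
(bootstrapping of `S₂¹`: Buss 1986, §2.4; Krajíček 1995, §5.4, p. 75). [cite: Krajicek1995, §5.4 (p. 75)] -/
theorem exists_isPow_mLen_eq_succ (S : M) {k : M} (hk : k ≤ mLen S) :
    ∃ p, p ≤ mSmash 1 S ∧ (IsPow p ∧ mLen p = k + 1) := by
  obtain ⟨y, -, hy⟩ := exists_mLen_eq hk
  refine ⟨mSmash 1 y, ?_, isPow_one_mSmash hP y, by rw [mLen_one_mSmash, hy]⟩
  rw [(isPow_one_mSmash hP y).le_iff_mLen_le, mLen_one_mSmash, mLen_one_mSmash, hy]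
  exact add_le_add_left hk 1

open scoped Classical in
/-- **`pw S k = 2 ^ min(k, |S|)`**: the power of two of length `min(k, |S|) + 1` (it exists by
`exists_isPow_mLen_eq_succ` and is unique by `IsPow.eq_of_mLen_eq`); the `S₂¹` counterpart of
`pow2B` (Buss 1986, §2.4: `2^{min(k,|S|)}`; Krajíček 1995, p. 75). [cite: Buss1986, §2.4] -/
noncomputable def pw (S k : M) : M :=
  if h : k ≤ mLen S then Classical.choose (exists_isPow_mLen_eq_succ S h) else mSmash 1 S

/-- The specification of `pw`. [cite: Buss1986, §2.4] -/
theorem pw_spec (S k : M) :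
    pw S k ≤ mSmash 1 S ∧ (IsPow (pw S k) ∧ mLen (pw S k) = min k (mLen S) + 1) := by
  unfold pw
  split_ifs with h
  · rw [min_eq_left h]
    exact Classical.choose_spec (exists_isPow_mLen_eq_succ S h)
  · rw [min_eq_right (not_le.1 h).le]
    exact ⟨le_rfl, isPow_one_mSmash hP S, mLen_one_mSmash S⟩

/-- `pw S k` is a power of two. [cite: Buss1986, §2.4] -/
theorem isPow_pw (S k : M) : IsPow (pw S k) := (pw_spec S k).2.1

/-- `|pw S k| = min(k, |S|) + 1`. [cite: Buss1986, §2.4] -/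
theorem mLen_pw (S k : M) : mLen (pw S k) = min k (mLen S) + 1 := (pw_spec S k).2.2

/-- `|pw S k| = k + 1` for `k ≤ |S|`. [cite: Buss1986, §2.4] -/
theorem mLen_pw_of_le {S k : M} (hk : k ≤ mLen S) : mLen (pw S k) = k + 1 := by
  rw [mLen_pw, min_eq_left hk]

/-- `pw S k ≤ 1 # S`. [cite: Buss1986, §2.4] -/
theorem pw_le (S k : M) : pw S k ≤ mSmash 1 S := (pw_spec S k).1

/-- `pw S k ≠ 0`. [cite: Buss1986, §2.4] -/
theorem pw_ne_zero (S k : M) : pw S k ≠ 0 := (isPow_pw S k).ne_zero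

/-- `0 < pw S k`. [cite: Buss1986, §2.4] -/
theorem pw_pos (S k : M) : 0 < pw S k := (pos_iff_ne_zero' _).2 (pw_ne_zero S k)

/-- `1 ≤ pw S k`. [cite: Buss1986, §2.4] -/
theorem one_le_pw (S k : M) : 1 ≤ pw S k := (one_le_iff_ne_zero' _).2 (pw_ne_zero S k)

/-- **Characterisation of `pw`** by "power of two of the right length" (uniqueness of powers of
two of a given length). [cite: Buss1986, §2.4] -/
theorem eq_pw_iff {S k y : M} : y = pw S k ↔ IsPow y ∧ mLen y = min k (mLen S) + 1 := by
  constructor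
  · rintro rfl
    exact ⟨isPow_pw S k, mLen_pw S k⟩
  · rintro ⟨hy, hlen⟩
    exact hy.eq_of_mLen_eq (isPow_pw S k) (by rw [hlen, mLen_pw])

/-- `pw S 0 = 1`. [cite: Buss1986, §2.4] -/
@[simp] theorem pw_zero (S : M) : pw S 0 = 1 :=
  (eq_pw_iff.2 ⟨isPow_one, by rw [mLen_one, min_eq_left (zero_le_model _), zero_add]⟩).symm

/-- **Recursion**: `pw S (k + 1) = 2 · pw S k` for `k < |S|`. [cite: Buss1986, §2.4] -/
theorem pw_succ {S k : M} (hk : k < mLen S) : pw S (k + 1) = 2 * pw S k := by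
  symm
  refine eq_pw_iff.2 ⟨(isPow_pw S k).two_mul, ?_⟩
  rw [(isPow_pw S k).mLen_two_mul, mLen_pw_of_le hk.le, min_eq_left ((add_one_le_iff' _ _).2 hk)]

/-- Above `|S|` the function `pw S` is constant. [folklore] -/
theorem pw_of_mLen_le {S k : M} (hk : mLen S ≤ k) : pw S k = pw S (mLen S) :=
  eq_pw_iff.2 ⟨isPow_pw S k, by rw [mLen_pw, min_eq_right hk, min_self]⟩

/-- `pw S |S| = 1 # S = 2^{|S|}`. [cite: Buss1986, §2.4] -/
theorem pw_mLen (S : M) : pw S (mLen S) = mSmash 1 S :=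
  (eq_pw_iff.2 ⟨isPow_one_mSmash hP S, by rw [mLen_one_mSmash, min_self]⟩).symm

/-- `pw` depends on the size parameter only through the truncation: for `k ≤ |S|, |S'|` the two
values agree. [folklore] -/
theorem pw_congr {S S' k : M} (hk : k ≤ mLen S) (hk' : k ≤ mLen S') : pw S k = pw S' k :=
  eq_pw_iff.2 ⟨isPow_pw S k, by rw [mLen_pw_of_le hk, min_eq_left hk']⟩

/-- **`x < 2ᵏ ↔ |x| ≤ k`** (`k ≤ |S|`). [cite: Buss1986, §2.4] -/
theorem lt_pw_iff {S k : M} (hk : k ≤ mLen S) (x : M) : x < pw S k ↔ mLen x ≤ k := by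
  rw [(isPow_pw S k).lt_iff_mLen_lt, mLen_pw_of_le hk, lt_add_one_iff']

/-- `2ᵏ ≤ x ↔ k < |x|` (`k ≤ |S|`). [cite: Buss1986, §2.4] -/
theorem pw_le_iff {S k : M} (hk : k ≤ mLen S) (x : M) : pw S k ≤ x ↔ k < mLen x := by
  rw [← not_lt, lt_pw_iff hk, not_le]

/-- `S < 2^{|S|}`. [cite: Buss1986, §2.4] -/
theorem lt_pw_mLen (S : M) : S < pw S (mLen S) := (lt_pw_iff le_rfl S).2 le_rfl

/-- `x < 2^{|S|}` as soon as `|x| ≤ |S|`. [cite: Buss1986, §2.4] -/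
theorem lt_pw_mLen_of_mLen_le {S x : M} (h : mLen x ≤ mLen S) : x < pw S (mLen S) :=
  (lt_pw_iff le_rfl x).2 h

/-- `pw S` is monotone. [folklore] -/
theorem pw_mono (S : M) {j k : M} (h : j ≤ k) : pw S j ≤ pw S k := by
  rw [(isPow_pw S j).le_iff_mLen_le, mLen_pw, mLen_pw]
  exact add_le_add_left (min_le_min_right _ h) 1

/-- The graph of `pw`: `y = pw S k ↔ IsPow y ∧ ((k ≤ |S| ∧ |y| = k + 1) ∨ (|S| < k ∧ |y| = |S| + 1))`
— a `Σᵇ₁` (indeed `Δᵇ₁`) condition. [folklore] -/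
theorem eq_pw_iff' {S k y : M} : y = pw S k ↔
    IsPow y ∧ ((k ≤ mLen S ∧ mLen y = k + 1) ∨ (mLen S < k ∧ mLen y = mLen S + 1)) := by
  rw [eq_pw_iff]
  refine and_congr_right fun _ => ?_
  rcases le_or_gt k (mLen S) with h | h
  · rw [min_eq_left h]
    simp [h, h.not_gt]
  · rw [min_eq_right h.le]
    simp [h, h.not_ge]

/-- **`pw` is a `Σᵇ₁`-definable function** of `(S, k)` (graph by `eq_pw_iff'`, bound `1 # S`).
[cite: Buss1986, §2.4] -/
theorem isSigmabFn_pw : IsSigmabFn 1 fun w : Fin 2 → M => pw (w 0) (w 1) := by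
  refine IsSigmabFn.of_unique (R := fun u : Fin 3 → M => IsPow (u 2) ∧
      ((u 1 ≤ mLen (u 0) ∧ mLen (u 2) = u 1 + 1) ∨ (mLen (u 0) < u 1 ∧ mLen (u 2) = mLen (u 0) + 1)))
    ?_ (fun w => ?_) (fun w y hy => ?_) ?_
  · refine (isSigmabDef_isPow.comp₁ (IsTermFn.proj 2)).and ?_
    exact ((((isQFDef_le (IsTermFn.proj 1) (IsTermFn.proj 0).len).and
      (IsQFDef.eq (IsTermFn.proj 2).len (isTermFn_add_one (IsTermFn.proj 1)))).or
      ((isQFDef_lt (IsTermFn.proj 0).len (IsTermFn.proj 1)).and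
        (IsQFDef.eq (IsTermFn.proj 2).len (isTermFn_add_one (IsTermFn.proj 0).len)))).isSigmabDef 1)
  · simpa using (eq_pw_iff' (S := w 0) (k := w 1) (y := pw (w 0) (w 1))).1 rfl
  · simpa using (eq_pw_iff' (S := w 0) (k := w 1) (y := y)).2 (by simpa using hy)
  · exact ⟨fun w => mSmash 1 (w 0), isTermFn_one.smash (IsTermFn.proj 0), fun w => pw_le _ _⟩

/-- `pw` is `Σᵇᵢ₊₁`-definable for every `i`. [folklore] -/
theorem isSigmabFn_pw' (i : ℕ) : IsSigmabFn (i + 1) fun w : Fin 2 → M => pw (w 0) (w 1) :=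
  isSigmabFn_pw.mono (Nat.le_add_left 1 i)

/-- **Multiplicativity**: `pw S (j + k) = pw S j · pw S k` for `j + k ≤ |S|`, by `Σᵇ₁`-induction on
`k` along `[0, |S|]` using `pw_succ` (Buss 1986, §2.4). [cite: Buss1986, §2.4] -/
theorem pw_add {S j k : M} (hjk : j + k ≤ mLen S) : pw S (j + k) = pw S j * pw S k := by
  have hk : k ≤ mLen S := (le_add_left'' k j).trans hjk
  revert hjk
  refine indLen (A := fun k => j + k ≤ mLen S → pw S (j + k) = pw S j * pw S k) ?_ S ?_ ?_ hk
  · refine IsSigmabDef.imp ((isQFDef_le (isTermFn_add (IsTermFn.const j) (IsTermFn.proj 0))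
      (IsTermFn.const (mLen S))).isPibDef 1) ?_
    have hF : IsSigmabFn 1 fun v : Fin 1 → M => pw S (j + v 0) :=
      (isSigmabFn_pw.comp₂ (IsTermFn.const S) (isTermFn_add (IsTermFn.const j) (IsTermFn.proj 0)))
    have hG : IsSigmabFn 1 fun v : Fin 1 → M => pw S j * pw S (v 0) := by
      refine (((isTermFn_mul (IsTermFn.proj 0) (IsTermFn.proj 1)).isSigmabFn
        (fun a => le_refl a) 1).comp₂Fn (f := fun a b => a * b) (IsTermFn.const (pw S j))
        (isSigmabFn_pw.comp₂ (IsTermFn.const S) (IsTermFn.proj 0))) ?_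
      exact ⟨fun _ => mSmash 1 S * mSmash 1 S, isTermFn_mul (isTermFn_one.smash (IsTermFn.const S))
        (isTermFn_one.smash (IsTermFn.const S)), fun v => mul_le_mul'' (pw_le _ _) (pw_le _ _)⟩
    exact (hF.isDeltabDef_eq hG).1
  · intro _
    rw [add_zero, pw_zero, mul_one]
  · intro k hk ih hjk
    have hjk' : j + k < mLen S := (add_one_le_iff' _ _).1 (by rwa [← add_assoc] at hjk)
    rw [← add_assoc, pw_succ hjk', ih hjk'.le, pw_succ hk]
    ring

/-! ## Division with remainder by a power of two -/

omit hP in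
/-- **Uniqueness of division with remainder**: `q·v + r = q'·v + r'` with `r, r' < v` forces
`q = q'` and `r = r'` (if `q < q'` then `q·v + r < (q+1)·v ≤ q'·v`). [folklore] -/
theorem divmod_unique {v q r q' r' : M} (hr : r < v) (hr' : r' < v)
    (h : q * v + r = q' * v + r') : q = q' ∧ r = r' := by
  have key : ∀ {q r q' r' : M}, r < v → q * v + r = q' * v + r' → ¬q < q' := by
    intro q r q' r' hr h hlt
    have h1 : q + 1 ≤ q' := (add_one_le_iff' _ _).2 hlt
    have h2 : (q + 1) * v ≤ q' * v := mul_le_mul'' h1 le_rfl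
    have h3 : q * v + r < (q + 1) * v := by
      rw [add_mul, one_mul]
      exact add_lt_add_right hr _
    have : q * v + r < q' * v + r' := lt_of_lt_of_le (h3.trans_le h2) (le_add_right'' _ _)
    exact this.ne h
  rcases lt_trichotomy q q' with hlt | rfl | hgt
  · exact absurd hlt (key hr h)
  · exact ⟨rfl, add_left_cancel h⟩
  · exact absurd hgt (key hr' h.symm)

omit hP in
/-- The induction predicate of `exists_divmod_isPow` is `Σᵇ₁` (with parameter `a`):
`∃v ≤ 1#a ∃q ≤ a ∃r ≤ a [(Pow(v) ∧ |v| = i + 1) ∧ (a = q·v + r ∧ r < v)]`. [folklore] -/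
private theorem isSigmabDef_divmod_ind (a : M) : IsSigmabDef 1 fun v : Fin 1 → M =>
    ∃ p, p ≤ mSmash 1 a ∧ ∃ q, q ≤ a ∧ ∃ r, r ≤ a ∧
      ((IsPow p ∧ mLen p = v 0 + 1) ∧ (a = q * p + r ∧ r < p)) := by
  have h4 : IsSigmabDef 1 fun u : Fin 4 → M =>
      (IsPow (u 1) ∧ mLen (u 1) = u 0 + 1) ∧ (a = u 2 * u 1 + u 3 ∧ u 3 < u 1) :=
    ((isSigmabDef_isPow.comp₁ (IsTermFn.proj 1)).and
      ((IsQFDef.eq (IsTermFn.proj 1).len (isTermFn_add_one (IsTermFn.proj 0))).isSigmabDef 1)).and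
      (((IsQFDef.eq (IsTermFn.const a) (isTermFn_add (isTermFn_mul (IsTermFn.proj 2)
        (IsTermFn.proj 1)) (IsTermFn.proj 3))).and
        (isQFDef_lt (IsTermFn.proj 3) (IsTermFn.proj 1))).isSigmabDef 1)
  have h3 : IsSigmabDef 1 fun u : Fin 3 → M => ∃ r, r ≤ a ∧
      ((IsPow (u 1) ∧ mLen (u 1) = u 0 + 1) ∧ (a = u 2 * u 1 + r ∧ r < u 1)) :=
    (h4.bexLE (IsTermFn.const a)).of_iff fun u => by simp
  have h2 : IsSigmabDef 1 fun u : Fin 2 → M => ∃ q, q ≤ a ∧ ∃ r, r ≤ a ∧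
      ((IsPow (u 1) ∧ mLen (u 1) = u 0 + 1) ∧ (a = q * u 1 + r ∧ r < u 1)) :=
    (h3.bexLE (IsTermFn.const a)).of_iff fun u => by simp
  exact (h2.bexLE (isTermFn_one.smash (IsTermFn.const a))).of_iff fun v => by simp

/-- **Division with remainder by a power of two** in a model of `BASIC + Σᵇ₁-PIND`: for every `a`
and every power of two `v` there are `q ≤ a` and `r ≤ a` with `a = q·v + r` and `r < v`
(whence `MSP` and `LSP`, Buss 1986, §2.4–2.5).  Proof without subtraction: if `|v| = k + 1`
with `k ≤ |a|`, `Σᵇ₁`-induction on `i ∈ [0, |a|]` produces the decomposition for the power of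
two of length `i + 1`, doubling it at each step (`(2h + e)·v + r = h·(2v) + (e·v + r)` with
`e = parity`); the result for `i = k` is the claim by uniqueness of powers of two of a given
length.  If `k > |a|` then `a < v` and `(0, a)` works. [cite: Buss1986, §2.4] -/
theorem exists_divmod_isPow (a : M) {v : M} (hv : IsPow v) :
    ∃ q, q ≤ a ∧ ∃ r, r ≤ a ∧ (a = q * v + r ∧ r < v) := by
  obtain ⟨k, hk⟩ := exists_eq_add_one_of_ne_zero_pind
    (show mLen v ≠ 0 from fun h => hv.ne_zero ((mLen_eq_zero_iff v).1 h))
  by_cases hka : k ≤ mLen a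
  · have key : ∃ p, p ≤ mSmash 1 a ∧ ∃ q, q ≤ a ∧ ∃ r, r ≤ a ∧
        ((IsPow p ∧ mLen p = k + 1) ∧ (a = q * p + r ∧ r < p)) := by
      refine indLen (A := fun i => ∃ p, p ≤ mSmash 1 a ∧ ∃ q, q ≤ a ∧ ∃ r, r ≤ a ∧
        ((IsPow p ∧ mLen p = i + 1) ∧ (a = q * p + r ∧ r < p))) (isSigmabDef_divmod_ind a) a
        ?_ ?_ hka
      · refine ⟨1, (one_le_iff_ne_zero' _).2 (mSmash_ne_zero _ _), a, le_rfl, 0, bot_le,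
          ⟨isPow_one, by rw [mLen_one, zero_add]⟩, by rw [mul_one, add_zero], ?_⟩
        exact lt_of_lt_of_eq (lt_add_one' 0) (zero_add 1)
      · rintro i hi ⟨p, -, q, hqa, r, -, ⟨hp, hlen⟩, hdec, hrp⟩
        have heq : a = mHalf q * (2 * p) + (parity q * p + r) :=
          calc a = q * p + r := hdec
            _ = (2 * mHalf q + parity q) * p + r := by rw [two_mul_mHalf_add_parity]
            _ = mHalf q * (2 * p) + (parity q * p + r) := by ring
        refine ⟨2 * p, ?_, mHalf q, (mHalf_le q).trans hqa, parity q * p + r, ?_,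
          ⟨hp.two_mul, by rw [hp.mLen_two_mul, hlen]⟩, heq, ?_⟩
        · rw [hp.two_mul.le_iff_mLen_le, hp.mLen_two_mul, hlen, mLen_one_mSmash]
          exact add_le_add_left ((add_one_le_iff' _ _).2 hi) 1
        · calc parity q * p + r ≤ mHalf q * (2 * p) + (parity q * p + r) := le_add_left'' _ _
            _ = a := heq.symm
        · have h1 : parity q * p ≤ p := by
            simpa using mul_le_mul'' (parity_le_one q) (le_refl p)
          calc parity q * p + r < parity q * p + p := add_lt_add_right hrp _
            _ ≤ p + p := add_le_add_left h1 _
            _ = 2 * p := (two_mul p).symm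
    obtain ⟨p, -, q, hqa, r, hra, ⟨hp, hlen⟩, hdec, hrp⟩ := key
    obtain rfl : p = v := hp.eq_of_mLen_eq hv (by rw [hlen, hk])
    exact ⟨q, hqa, r, hra, hdec, hrp⟩
  · refine ⟨0, bot_le, a, le_rfl, by rw [zero_mul, zero_add], ?_⟩
    rw [hv.lt_iff_mLen_lt, hk]
    exact (lt_add_one_iff' _ _).2 (not_le.1 hka).le

/-! ## `MSP` and `LSP` -/

/-- **`msp S a k = ⌊a / 2ᵏ⌋`** (`k ≤ |S|`; Buss's `MSP(a, k)`, the `k`-fold right shift): the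
quotient of the division of `a` by `pw S k` (Buss 1986, §2.4–2.5; Krajíček 1995, §5.4).
[cite: Buss1986, §2.5] -/
noncomputable def msp (S a k : M) : M :=
  Classical.choose (exists_divmod_isPow a (isPow_pw S k))

/-- **`lsp S a k = a mod 2ᵏ`** (`k ≤ |S|`; Buss's `LSP(a, k)`, the `k` low bits): the remainder of
the division of `a` by `pw S k` (Buss 1986, §2.4–2.5). [cite: Buss1986, §2.5] -/
noncomputable def lsp (S a k : M) : M :=
  Classical.choose (Classical.choose_spec (exists_divmod_isPow a (isPow_pw S k))).2

/-- The specification of `msp`/`lsp`: `a = msp·2ᵏ + lsp`, `lsp < 2ᵏ`, both `≤ a`.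
[cite: Buss1986, §2.5] -/
theorem msp_lsp_spec (S a k : M) :
    msp S a k ≤ a ∧ lsp S a k ≤ a ∧ (a = msp S a k * pw S k + lsp S a k ∧ lsp S a k < pw S k) := by
  have h1 := Classical.choose_spec (exists_divmod_isPow a (isPow_pw S k))
  have h2 := Classical.choose_spec h1.2
  exact ⟨h1.1, h2.1, h2.2⟩

/-- `a = msp S a k · pw S k + lsp S a k`. [cite: Buss1986, §2.5] -/
theorem msp_mul_pw_add_lsp (S a k : M) : msp S a k * pw S k + lsp S a k = a :=
  (msp_lsp_spec S a k).2.2.1.symm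

/-- `lsp S a k < pw S k`. [cite: Buss1986, §2.5] -/
theorem lsp_lt_pw (S a k : M) : lsp S a k < pw S k := (msp_lsp_spec S a k).2.2.2

/-- `msp S a k ≤ a`. [cite: Buss1986, §2.5] -/
theorem msp_le (S a k : M) : msp S a k ≤ a := (msp_lsp_spec S a k).1

/-- `lsp S a k ≤ a`. [cite: Buss1986, §2.5] -/
theorem lsp_le (S a k : M) : lsp S a k ≤ a := (msp_lsp_spec S a k).2.1

/-- **Characterisation**: any decomposition `a = q·2ᵏ + r` with `r < 2ᵏ` is the `msp`/`lsp`
decomposition. [cite: Buss1986, §2.5] -/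
theorem eq_msp_and_eq_lsp {S a k q r : M} (h : a = q * pw S k + r) (hr : r < pw S k) :
    q = msp S a k ∧ r = lsp S a k :=
  divmod_unique hr (lsp_lt_pw S a k) (h.symm.trans (msp_mul_pw_add_lsp S a k).symm)

/-- The joint graph of `(msp, lsp)`: `q = msp ∧ r = lsp ↔ a = q·2ᵏ + r ∧ r < 2ᵏ`. [cite: Buss1986, §2.5] -/
theorem msp_lsp_iff {S a k q r : M} :
    (q = msp S a k ∧ r = lsp S a k) ↔ (a = q * pw S k + r ∧ r < pw S k) := by
  constructor
  · rintro ⟨rfl, rfl⟩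
    exact ⟨(msp_mul_pw_add_lsp S a k).symm, lsp_lt_pw S a k⟩
  · rintro ⟨h, hr⟩
    exact eq_msp_and_eq_lsp h hr

/-- The graph of `msp`: `q = msp S a k ↔ ∃ r ≤ a (a = q·2ᵏ + r ∧ r < 2ᵏ)`. [cite: Buss1986, §2.5] -/
theorem eq_msp_iff {S a k q : M} :
    q = msp S a k ↔ ∃ r, r ≤ a ∧ (a = q * pw S k + r ∧ r < pw S k) := by
  constructor
  · rintro rfl
    exact ⟨lsp S a k, lsp_le S a k, (msp_mul_pw_add_lsp S a k).symm, lsp_lt_pw S a k⟩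
  · rintro ⟨r, -, h, hr⟩
    exact (eq_msp_and_eq_lsp h hr).1

/-- The graph of `lsp`: `r = lsp S a k ↔ ∃ q ≤ a (a = q·2ᵏ + r ∧ r < 2ᵏ)`. [cite: Buss1986, §2.5] -/
theorem eq_lsp_iff {S a k r : M} :
    r = lsp S a k ↔ ∃ q, q ≤ a ∧ (a = q * pw S k + r ∧ r < pw S k) := by
  constructor
  · rintro rfl
    exact ⟨msp S a k, msp_le S a k, (msp_mul_pw_add_lsp S a k).symm, lsp_lt_pw S a k⟩
  · rintro ⟨q, -, h, hr⟩
    exact (eq_msp_and_eq_lsp h hr).2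

/-- The ternary relation `a = q · pw S k + r ∧ r < pw S k` is `Σᵇ₁`-definable in
`(S, a, k, q, r)` (substituting the `Σᵇ₁`-definable `pw`). [folklore] -/
private theorem isSigmabDef_divmod_rel : IsSigmabDef 1 fun u : Fin 5 → M =>
    u 1 = u 3 * pw (u 0) (u 2) + u 4 ∧ u 4 < pw (u 0) (u 2) := by
  -- `P(x̄, p) :≡ a = q·p + r ∧ r < p` with `p := pw S k` substituted
  have hP0 : IsSigmabDef 1 fun w : Fin 6 → M => w 1 = w 3 * w 5 + w 4 ∧ w 4 < w 5 :=
    ((IsQFDef.eq (IsTermFn.proj 1) (isTermFn_add (isTermFn_mul (IsTermFn.proj 3) (IsTermFn.proj 5))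
      (IsTermFn.proj 4))).and (isQFDef_lt (IsTermFn.proj 4) (IsTermFn.proj 5))).isSigmabDef 1
  have hpw : IsSigmabFn 1 fun u : Fin 5 → M => pw (u 0) (u 2) :=
    isSigmabFn_pw.comp ![(0 : Fin 5), 2]
  exact (hP0.snocFn hpw).of_iff fun u => by simp

/-- **`msp` is a `Σᵇ₁`-definable function** of `(S, a, k)` (bounded by `a`). [cite: Buss1986, §2.5] -/
theorem isSigmabFn_msp : IsSigmabFn 1 fun u : Fin 3 → M => msp (u 0) (u 1) (u 2) := by
  refine IsSigmabFn.of_unique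
    (R := fun u : Fin 4 → M => ∃ r, r ≤ u 1 ∧ (u 1 = u 3 * pw (u 0) (u 2) + r ∧ r < pw (u 0) (u 2)))
    ?_ (fun u => ?_) (fun u q hq => ?_) ⟨fun u => u 1, IsTermFn.proj 1, fun u => msp_le _ _ _⟩
  · exact (isSigmabDef_divmod_rel.bexLE (IsTermFn.proj 1)).of_iff fun u => by simp
  · simpa using (eq_msp_iff (S := u 0) (a := u 1) (k := u 2) (q := msp (u 0) (u 1) (u 2))).1 rfl
  · exact eq_msp_iff.2 (by simpa using hq)

/-- **`lsp` is a `Σᵇ₁`-definable function** of `(S, a, k)` (bounded by `a`). [cite: Buss1986, §2.5] -/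
theorem isSigmabFn_lsp : IsSigmabFn 1 fun u : Fin 3 → M => lsp (u 0) (u 1) (u 2) := by
  refine IsSigmabFn.of_unique
    (R := fun u : Fin 4 → M => ∃ q, q ≤ u 1 ∧ (u 1 = q * pw (u 0) (u 2) + u 3 ∧ u 3 < pw (u 0) (u 2)))
    ?_ (fun u => ?_) (fun u r hr => ?_) ⟨fun u => u 1, IsTermFn.proj 1, fun u => lsp_le _ _ _⟩
  · exact ((isSigmabDef_divmod_rel.comp ![(0 : Fin 5), 1, 2, 4, 3]).bexLE (IsTermFn.proj 1)).of_iff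
      fun u => by simp
  · simpa using (eq_lsp_iff (S := u 0) (a := u 1) (k := u 2) (r := lsp (u 0) (u 1) (u 2))).1 rfl
  · exact eq_lsp_iff.2 (by simpa using hr)

/-- `msp` is `Σᵇᵢ₊₁`-definable for every `i`. [folklore] -/
theorem isSigmabFn_msp' (i : ℕ) : IsSigmabFn (i + 1) fun u : Fin 3 → M => msp (u 0) (u 1) (u 2) :=
  isSigmabFn_msp.mono (Nat.le_add_left 1 i)

/-- `lsp` is `Σᵇᵢ₊₁`-definable for every `i`. [folklore] -/
theorem isSigmabFn_lsp' (i : ℕ) : IsSigmabFn (i + 1) fun u : Fin 3 → M => lsp (u 0) (u 1) (u 2) :=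
  isSigmabFn_lsp.mono (Nat.le_add_left 1 i)

/-! ### First algebra of `msp` / `lsp` -/

/-- `msp S a 0 = a`. [cite: Buss1986, §2.5] -/
@[simp] theorem msp_zero_right (S a : M) : msp S a 0 = a :=
  (eq_msp_and_eq_lsp (q := a) (r := 0) (by rw [pw_zero, mul_one, add_zero])
    (by rw [pw_zero]; exact lt_of_lt_of_eq (lt_add_one' 0) (zero_add 1))).1.symm

/-- `lsp S a 0 = 0`. [cite: Buss1986, §2.5] -/
@[simp] theorem lsp_zero_right (S a : M) : lsp S a 0 = 0 :=
  (eq_msp_and_eq_lsp (q := a) (r := 0) (by rw [pw_zero, mul_one, add_zero])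
    (by rw [pw_zero]; exact lt_of_lt_of_eq (lt_add_one' 0) (zero_add 1))).2.symm

/-- `msp S 0 k = 0`. [folklore] -/
@[simp] theorem msp_zero_mid (S k : M) : msp S 0 k = 0 :=
  (eq_msp_and_eq_lsp (q := 0) (r := 0) (by rw [zero_mul, add_zero]) (pw_pos S k)).1.symm

/-- `lsp S 0 k = 0`. [folklore] -/
@[simp] theorem lsp_zero_mid (S k : M) : lsp S 0 k = 0 :=
  (eq_msp_and_eq_lsp (q := 0) (r := 0) (by rw [zero_mul, add_zero]) (pw_pos S k)).2.symm

/-- If `a < 2ᵏ` then `msp S a k = 0`. [cite: Buss1986, §2.5] -/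
theorem msp_eq_zero_of_lt {S a k : M} (h : a < pw S k) : msp S a k = 0 :=
  (eq_msp_and_eq_lsp (q := 0) (r := a) (by rw [zero_mul, zero_add]) h).1.symm

/-- If `a < 2ᵏ` then `lsp S a k = a`. [cite: Buss1986, §2.5] -/
theorem lsp_eq_self_of_lt {S a k : M} (h : a < pw S k) : lsp S a k = a :=
  (eq_msp_and_eq_lsp (q := 0) (r := a) (by rw [zero_mul, zero_add]) h).2.symm

/-- `msp S a k = 0 ↔ a < 2ᵏ`. [cite: Buss1986, §2.5] -/
theorem msp_eq_zero_iff {S a k : M} : msp S a k = 0 ↔ a < pw S k := by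
  refine ⟨fun h => ?_, msp_eq_zero_of_lt⟩
  have := msp_mul_pw_add_lsp S a k
  rw [h, zero_mul, zero_add] at this
  rw [← this]
  exact lsp_lt_pw S a k

/-- For `|a| ≤ k ≤ |S|`: `msp S a k = 0`. [cite: Buss1986, §2.5] -/
theorem msp_eq_zero_of_mLen_le {S a k : M} (hk : k ≤ mLen S) (ha : mLen a ≤ k) : msp S a k = 0 :=
  msp_eq_zero_of_lt ((lt_pw_iff hk a).2 ha)

/-- `msp S a |S| = 0` when `|a| ≤ |S|`. [cite: Buss1986, §2.5] -/
theorem msp_mLen_eq_zero {S a : M} (ha : mLen a ≤ mLen S) : msp S a (mLen S) = 0 :=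
  msp_eq_zero_of_mLen_le le_rfl ha

/-- **Right-shift recursion**: `msp S a (k + 1) = ⌊msp S a k / 2⌋` and
`lsp S a (k + 1) = lsp S a k + parity (msp S a k) · 2ᵏ` (`k < |S|`) (Buss 1986, §2.5: `MSP` by
limited iteration of `⌊·/2⌋`). [cite: Buss1986, §2.5] -/
theorem msp_succ_and_lsp_succ {S a k : M} (hk : k < mLen S) :
    msp S a (k + 1) = mHalf (msp S a k) ∧
      lsp S a (k + 1) = parity (msp S a k) * pw S k + lsp S a k := by
  have hdec : a = mHalf (msp S a k) * pw S (k + 1) + (parity (msp S a k) * pw S k + lsp S a k) :=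
    calc a = msp S a k * pw S k + lsp S a k := (msp_mul_pw_add_lsp S a k).symm
      _ = (2 * mHalf (msp S a k) + parity (msp S a k)) * pw S k + lsp S a k := by
          rw [two_mul_mHalf_add_parity]
      _ = mHalf (msp S a k) * pw S (k + 1) + (parity (msp S a k) * pw S k + lsp S a k) := by
          rw [pw_succ hk]; ring
  have hlt : parity (msp S a k) * pw S k + lsp S a k < pw S (k + 1) := by
    have h1 : parity (msp S a k) * pw S k ≤ pw S k := by
      simpa using mul_le_mul'' (parity_le_one (msp S a k)) (le_refl (pw S k))
    calc parity (msp S a k) * pw S k + lsp S a k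
        < parity (msp S a k) * pw S k + pw S k := add_lt_add_right (lsp_lt_pw S a k) _
      _ ≤ pw S k + pw S k := add_le_add_left h1 _
      _ = pw S (k + 1) := by rw [pw_succ hk, two_mul]
  obtain ⟨h1, h2⟩ := eq_msp_and_eq_lsp hdec hlt
  exact ⟨h1.symm, h2.symm⟩

/-- `msp S a (k + 1) = ⌊msp S a k / 2⌋` (`k < |S|`). [cite: Buss1986, §2.5] -/
theorem msp_succ {S a k : M} (hk : k < mLen S) : msp S a (k + 1) = mHalf (msp S a k) :=
  (msp_succ_and_lsp_succ hk).1

/-- `lsp S a (k + 1) = parity (msp S a k) · 2ᵏ + lsp S a k` (`k < |S|`). [cite: Buss1986, §2.5] -/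
theorem lsp_succ {S a k : M} (hk : k < mLen S) :
    lsp S a (k + 1) = parity (msp S a k) * pw S k + lsp S a k :=
  (msp_succ_and_lsp_succ hk).2

/-- `msp S a 1 = ⌊a/2⌋` (`|S| ≥ 1`). [cite: Buss1986, §2.5] -/
theorem msp_one {S : M} (hS : 1 ≤ mLen S) (a : M) : msp S a 1 = mHalf a := by
  have := msp_succ (S := S) (a := a) (k := 0) (lt_of_lt_of_le (lt_add_one' 0) (by simpa using hS))
  rwa [zero_add, msp_zero_right] at this

/-- `lsp S a 1 = parity a` (`|S| ≥ 1`). [cite: Buss1986, §2.5] -/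
theorem lsp_one {S : M} (hS : 1 ≤ mLen S) (a : M) : lsp S a 1 = parity a := by
  have := lsp_succ (S := S) (a := a) (k := 0) (lt_of_lt_of_le (lt_add_one' 0) (by simpa using hS))
  rwa [zero_add, msp_zero_right, pw_zero, mul_one, lsp_zero_right, add_zero] at this

/-- **Appending above**: if `a < 2ᵏ` then `msp S (c·2ᵏ + a) k = c` and `lsp S (c·2ᵏ + a) k = a`.
[cite: Buss1986, §2.5] -/
theorem msp_lsp_mul_pw_add {S a k : M} (ha : a < pw S k) (c : M) :
    msp S (c * pw S k + a) k = c ∧ lsp S (c * pw S k + a) k = a := by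
  obtain ⟨h1, h2⟩ := eq_msp_and_eq_lsp (S := S) (a := c * pw S k + a) (q := c) (r := a) rfl ha
  exact ⟨h1.symm, h2.symm⟩

/-- `msp` is monotone in `a`. [folklore] -/
theorem msp_mono {S a a' : M} (h : a ≤ a') (k : M) : msp S a k ≤ msp S a' k := by
  by_contra hlt
  rw [not_le, ← add_one_le_iff'] at hlt
  have h1 : (msp S a' k + 1) * pw S k ≤ msp S a k * pw S k := mul_le_mul'' hlt le_rfl
  have h2 : a' < (msp S a' k + 1) * pw S k := by
    conv_lhs => rw [← msp_mul_pw_add_lsp S a' k]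
    rw [add_mul, one_mul]
    exact add_lt_add_right (lsp_lt_pw S a' k) _
  have h3 : msp S a k * pw S k ≤ a := by
    conv_rhs => rw [← msp_mul_pw_add_lsp S a k]
    exact le_add_right'' _ _
  exact (lt_irrefl a') (lt_of_lt_of_le h2 (h1.trans (h3.trans h)))

/-! ### Shifting by a sum; digits -/

/-- A remainder bound propagates through scaling: `r₂ < 2ᵏ`, `r₁ < 2ʲ` give
`r₂·2ʲ + r₁ < 2ᵏ·2ʲ`. [folklore] -/
theorem mul_pw_add_lt {S j k r₁ r₂ : M} (h₁ : r₁ < pw S j) (h₂ : r₂ < pw S k) :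
    r₂ * pw S j + r₁ < pw S k * pw S j := by
  have h3 : (r₂ + 1) * pw S j ≤ pw S k * pw S j :=
    mul_le_mul'' ((add_one_le_iff' _ _).2 h₂) le_rfl
  calc r₂ * pw S j + r₁ < r₂ * pw S j + pw S j := add_lt_add_right h₁ _
    _ = (r₂ + 1) * pw S j := by ring
    _ ≤ pw S k * pw S j := h3

/-- **Shifting by a sum**: `msp S a (j + k) = msp S (msp S a j) k` and
`lsp S a (j + k) = lsp S (msp S a j) k · 2ʲ + lsp S a j` (`j + k ≤ |S|`) (Buss 1986, §2.5:
`MSP(a, j + k) = MSP(MSP(a, j), k)`). [cite: Buss1986, §2.5] -/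
theorem msp_add_and_lsp_add {S a j k : M} (hjk : j + k ≤ mLen S) :
    msp S a (j + k) = msp S (msp S a j) k ∧
      lsp S a (j + k) = lsp S (msp S a j) k * pw S j + lsp S a j := by
  have hdec : a = msp S (msp S a j) k * pw S (j + k) + (lsp S (msp S a j) k * pw S j + lsp S a j) :=
    calc a = msp S a j * pw S j + lsp S a j := (msp_mul_pw_add_lsp S a j).symm
      _ = (msp S (msp S a j) k * pw S k + lsp S (msp S a j) k) * pw S j + lsp S a j := by
          rw [msp_mul_pw_add_lsp S (msp S a j) k]
      _ = msp S (msp S a j) k * pw S (j + k) + (lsp S (msp S a j) k * pw S j + lsp S a j) := by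
          rw [pw_add hjk]; ring
  have hlt : lsp S (msp S a j) k * pw S j + lsp S a j < pw S (j + k) := by
    rw [pw_add hjk, mul_comm (pw S j)]
    exact mul_pw_add_lt (lsp_lt_pw S a j) (lsp_lt_pw S _ k)
  obtain ⟨h1, h2⟩ := eq_msp_and_eq_lsp hdec hlt
  exact ⟨h1.symm, h2.symm⟩

/-- `msp S a (j + k) = msp S (msp S a j) k` (`j + k ≤ |S|`). [cite: Buss1986, §2.5] -/
theorem msp_add {S a j k : M} (hjk : j + k ≤ mLen S) : msp S a (j + k) = msp S (msp S a j) k :=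
  (msp_add_and_lsp_add hjk).1

/-- `lsp S a (j + k) = lsp S (msp S a j) k · 2ʲ + lsp S a j` (`j + k ≤ |S|`). [cite: Buss1986, §2.5] -/
theorem lsp_add {S a j k : M} (hjk : j + k ≤ mLen S) :
    lsp S a (j + k) = lsp S (msp S a j) k * pw S j + lsp S a j :=
  (msp_add_and_lsp_add hjk).2

/-- **Digit extraction**: the `k` bits of `a` above position `j` can be read in either order —
`msp S (lsp S a (j + k)) j = lsp S (msp S a j) k` (`j + k ≤ |S|`) (Buss 1986, §2.5, the function
`β`). [cite: Buss1986, §2.5] -/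
theorem msp_lsp_comm {S a j k : M} (hjk : j + k ≤ mLen S) :
    msp S (lsp S a (j + k)) j = lsp S (msp S a j) k :=
  (msp_lsp_mul_pw_add (lsp_lt_pw S a j) (lsp S (msp S a j) k)).1.symm.trans
    (by rw [← lsp_add hjk]) |>.symm

/-- Low parts are nested: `lsp S (lsp S a (j + k)) j = lsp S a j` (`j + k ≤ |S|`). [cite: Buss1986, §2.5] -/
theorem lsp_lsp_add {S a j k : M} (hjk : j + k ≤ mLen S) : lsp S (lsp S a (j + k)) j = lsp S a j := by
  rw [lsp_add hjk]
  exact (msp_lsp_mul_pw_add (lsp_lt_pw S a j) _).2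

/-- Low parts below a smaller position are unchanged: `lsp S (lsp S a j) (j + k) = lsp S a j`. [folklore] -/
theorem lsp_lsp_of_le {S a j k : M} (hjk : j ≤ k) : lsp S (lsp S a j) k = lsp S a j :=
  lsp_eq_self_of_lt ((lsp_lt_pw S a j).trans_le (pw_mono S hjk))

/-- `msp S (lsp S a j) k = 0` for `j ≤ k`. [folklore] -/
theorem msp_lsp_of_le {S a j k : M} (hjk : j ≤ k) : msp S (lsp S a j) k = 0 :=
  msp_eq_zero_of_lt ((lsp_lt_pw S a j).trans_le (pw_mono S hjk))

/-- **Adding a multiple of `2ᵐ` does not change the bits below `m`**: for `j ≤ m ≤ |S|`,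
`lsp S (c·2ᵐ + a) j = lsp S a j` and `msp S (c·2ᵐ + a) j = c·2^{m-j} + msp S a j` (stated with
the difference `d`, `j + d = m`). [cite: Buss1986, §2.5] -/
theorem msp_lsp_mul_pw_add_of_le {S a j d : M} (hjd : j + d ≤ mLen S) (c : M) :
    msp S (c * pw S (j + d) + a) j = c * pw S d + msp S a j ∧
      lsp S (c * pw S (j + d) + a) j = lsp S a j := by
  have hdec : c * pw S (j + d) + a = (c * pw S d + msp S a j) * pw S j + lsp S a j := by
    conv_lhs => rw [← msp_mul_pw_add_lsp S a j, pw_add hjd]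
    ring
  obtain ⟨h1, h2⟩ := eq_msp_and_eq_lsp hdec (lsp_lt_pw S a j)
  exact ⟨h1.symm, h2.symm⟩

/-- Adding a multiple of `2ᵐ` shifts `msp … m` by the factor: `msp S (c·2ᵐ + a) m = c + msp S a m`.
[cite: Buss1986, §2.5] -/
theorem msp_mul_pw_add_self {S a m : M} (c : M) : msp S (c * pw S m + a) m = c + msp S a m := by
  have hdec : c * pw S m + a = (c + msp S a m) * pw S m + lsp S a m := by
    conv_lhs => rw [← msp_mul_pw_add_lsp S a m]
    ring
  exact (eq_msp_and_eq_lsp hdec (lsp_lt_pw S a m)).1.symm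

/-- `lsp S (c·2ᵐ + a) m = lsp S a m`. [cite: Buss1986, §2.5] -/
theorem lsp_mul_pw_add_self {S a m : M} (c : M) : lsp S (c * pw S m + a) m = lsp S a m := by
  have hdec : c * pw S m + a = (c + msp S a m) * pw S m + lsp S a m := by
    conv_lhs => rw [← msp_mul_pw_add_lsp S a m]
    ring
  exact (eq_msp_and_eq_lsp hdec (lsp_lt_pw S a m)).2.symm

/-- `lsp S a k < 2ᵏ` in length form: `|lsp S a k| ≤ k` (`k ≤ |S|`). [cite: Buss1986, §2.5] -/
theorem mLen_lsp_le {S a k : M} (hk : k ≤ mLen S) : mLen (lsp S a k) ≤ k :=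
  (lt_pw_iff hk _).1 (lsp_lt_pw S a k)

/-- `msp` is antitone in the shift: `msp S a (j + k) ≤ msp S a j`. [folklore] -/
theorem msp_add_le {S a j k : M} (hjk : j + k ≤ mLen S) : msp S a (j + k) ≤ msp S a j := by
  rw [msp_add hjk]
  exact msp_le _ _ _

/-! ### Bits -/

/-- **`bit S a k`**: the bit of `a` at position `k` (`k < |S|`), `= parity (msp S a k)` (Buss's
`Bit(k, a)`; Krajíček 1995, p. 75, `bit(a, i)`). [cite: Buss1986, §2.5] -/
noncomputable def bit (S a k : M) : M := parity (msp S a k)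

/-- `bit S a k ≤ 1`. [cite: Buss1986, §2.5] -/
theorem bit_le_one (S a k : M) : bit S a k ≤ 1 := parity_le_one _

/-- `lsp S a (k + 1) = bit S a k · 2ᵏ + lsp S a k` (`k < |S|`). [cite: Buss1986, §2.5] -/
theorem lsp_succ_bit {S a k : M} (hk : k < mLen S) : lsp S a (k + 1) = bit S a k * pw S k + lsp S a k :=
  lsp_succ hk

/-- `msp S a k = 2 · msp S a (k + 1) + bit S a k` (`k < |S|`). [cite: Buss1986, §2.5] -/
theorem msp_eq_two_mul_msp_succ_add_bit {S a k : M} (hk : k < mLen S) :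
    msp S a k = 2 * msp S a (k + 1) + bit S a k := by
  rw [msp_succ hk, bit, two_mul_mHalf_add_parity]

/-- `bit S a k = lsp S (msp S a k) 1` (`k + 1 ≤ |S|`). [cite: Buss1986, §2.5] -/
theorem bit_eq_lsp_msp {S a k : M} (hk : k + 1 ≤ mLen S) : bit S a k = lsp S (msp S a k) 1 := by
  rw [bit, lsp_one ((le_add_left'' 1 k).trans hk)]

/-- `bit` is a `Σᵇ₁`-definable function of `(S, a, k)`. [cite: Buss1986, §2.5] -/
theorem isSigmabFn_bit : IsSigmabFn 1 fun u : Fin 3 → M => bit (u 0) (u 1) (u 2) :=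
  (isSigmabFn_parity 1).comp₁Fn isSigmabFn_msp ⟨fun _ => 1, isTermFn_one, fun _ => bit_le_one _ _ _⟩

/-- Bits above the length vanish: `bit S a k = 0` if `|a| ≤ k ≤ |S|`. [cite: Buss1986, §2.5] -/
theorem bit_eq_zero_of_mLen_le {S a k : M} (hk : k ≤ mLen S) (ha : mLen a ≤ k) : bit S a k = 0 := by
  rw [bit, msp_eq_zero_of_mLen_le hk ha, parity_zero]

/-- **Extensionality below a position**: if the bits of `a` and `b` agree below `n ≤ |S|` then
`lsp S a n = lsp S b n` — by `Σᵇ₁`-induction on `i ∈ [0, n]` for `lsp S a i = lsp S b i`, using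
`lsp_succ_bit` (Buss 1986, §2.5). [cite: Buss1986, §2.5] -/
theorem lsp_eq_lsp_of_bit_eq {S a b n : M} (hn : n ≤ mLen S)
    (h : ∀ k, k < n → bit S a k = bit S b k) : lsp S a n = lsp S b n := by
  obtain ⟨y, -, hy⟩ := exists_mLen_eq hn
  subst hy
  refine indLen (A := fun i => lsp S a i = lsp S b i) ?_ y (by simp) ?_ le_rfl
  · exact ((isSigmabFn_lsp.comp₃ (IsTermFn.const S) (IsTermFn.const a) (IsTermFn.proj 0)).isDeltabDef_eq
      (isSigmabFn_lsp.comp₃ (IsTermFn.const S) (IsTermFn.const b) (IsTermFn.proj 0))).1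
  · intro k hk ih
    have hkS : k < mLen S := lt_of_lt_of_le hk hn
    rw [lsp_succ_bit hkS, lsp_succ_bit hkS, ih, h k hk]

/-- **Extensionality**: numbers of length `≤ n ≤ |S|` with the same bits below `n` are equal
(Buss 1986, §2.5; Krajíček 1995, §5.4). [cite: Buss1986, §2.5] -/
theorem eq_of_bit_eq {S a b n : M} (hn : n ≤ mLen S) (ha : mLen a ≤ n) (hb : mLen b ≤ n)
    (h : ∀ k, k < n → bit S a k = bit S b k) : a = b := by
  have := lsp_eq_lsp_of_bit_eq hn h
  rwa [lsp_eq_self_of_lt ((lt_pw_iff hn a).2 ha), lsp_eq_self_of_lt ((lt_pw_iff hn b).2 hb)] at this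

end S21

end BASICModel

end Literature.Computability.MetaComplexity
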